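import Mathlib
import Literature.AlgebraicGeometry.Resolution.WeightedCentreInvariantDirection

/-!
# Weighted centres — the CLASS-LINEAR pin condition `(P)_S` and the repaired rank-one step

Instrument for the cell's weighted-centre toy model `W(f)` (engine 1, THEOREM B⁗ (i) RANK ONE / THEOREM F STEP 4 of the cell notes);
NOT a resolution theorem, NOT a statement about the Abramovich–Temkin–Włodarczyk invariant, NOT summit mathematics.

## What this file records

1. **A vacuity finding** (`false_of_notMem_vars_of_forall_mem_vars_linSubst`,
   `card_le_one_of_D_eq_zero_hypotheses_inconsistent`).  The formal pin hypothesis `hPin` of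
   `InvariantDirection.card_le_one_of_pderiv_eq_zero`, `InvariantDirection.card_le_one_of_D_eq_zero` and
   `InvariantDirection.card_le_one_of_D_eq_zero_of_surjective_frobenius` — "`X_{i₀}` occurs in `P∘A` for EVERY invertible matrix `A` on ALL
   slots" — is unsatisfiable as soon as some variable `X_n` does not occur in `P`: the GL-move `exists_mul_eq_one_col_eq` puts `e_n`, an
   invariant direction of `P`, into column `i₀`.  In `card_le_one_of_D_eq_zero` the `W`-variables `n ∈ T` are required NOT to occur in `P`
   (`hPT`), so for `T ≠ ∅` its hypotheses are jointly inconsistent: the theorem is correct but carries no content there (and for `T = ∅` the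
   right-inverse hypothesis forces `r` empty, `isEmpty_of_rightInverse_empty`).  The cell's model-level (P) only ever changes coordinates
   INSIDE one weight class; the all-slots reading was an artefact of the typing.
2. **The repair**: `IsClassLinear S A` (the matrix is the identity outside the `S × S` block) and the class-linear pin condition
   `ClassPinned S P i₀` ("`X_{i₀}` occurs in `P∘A` for every invertible class-linear `A`"), with its dictionary
   `ClassPinned S P i₀ ↔ (P has no non-zero invariant direction supported in S)` for `i₀ ∈ S` (`classPinned_iff_forall_not_isInvariantDir`),
   the class GL-move (`exists_classLinear_col_eq`), transport under class-linear substitutions (`ClassPinned.map_linSubst`), gradedness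
   (`IsClassLinear.isWeightedHomogeneous_linSubst`), and the singleton case `ClassPinned {i} P i ↔ i ∈ P.vars` (`classPinned_singleton_iff`)
   — so `(P)_S` is satisfiable.
3. **The rank-one chain re-proved under `(P)_S`**: `card_le_one_of_forall_mem_vars_class`, `card_le_one_of_pderiv_eq_zero_class`,
   `card_le_one_of_D_eq_zero_class`, `card_le_one_of_D_eq_zero_of_surjective_frobenius_class` — same conclusions as the originals, the pin
   hypothesis now restricted to a class `Scl ⊇` (moved slots) containing `i₀`, hence consistent with "`P` is free of the `W`-variables";
   a fully instantiated consistency witness over `𝔽₂` closes the file.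

References: linear substitutions and invariant directions [Lang2002, Ch. IV §1, Ch. XIII §4]; Frobenius forms [Lang2002, Ch. V §6];
the weighted-centre context of the toy model [AbramovichTemkinWlodarczyk2024, §5.1].
-/

namespace Literature.AlgebraicGeometry.Resolution.WeightedBlowup

namespace InvariantDirection

open MvPolynomial

variable {ι : Type*} [Fintype ι] [DecidableEq ι] {L : Type*} [Field L]

/-! ## 1. The all-slots pin hypothesis is vacuous as soon as a variable is missing -/

/-- **Vacuity witness** (ours): if some variable `X_n` does not occur in `P`, then "`X_{i₀}` occurs in `P∘A` for every invertible `A`"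
is false — the invertible matrix with column `i₀` equal to `e_n` (`exists_mul_eq_one_col_eq`) tests `e_n`, an invariant direction of
`P`.  Instrument-level bookkeeping for the `W(f)` toy model. [cite: Lang2002, Ch. IV §1] -/
theorem false_of_notMem_vars_of_forall_mem_vars_linSubst (P : MvPolynomial ι L) {n : ι} (hn : n ∉ P.vars) (i₀ : ι)
    (hPin : ∀ A A' : Matrix ι ι L, A * A' = 1 → A' * A = 1 → i₀ ∈ (linSubst (fun j k => A j k) P).vars) : False :=
  not_isInvariantDir_of_forall_mem_vars P i₀ hPin (v := Pi.single n 1) (fun h => by simpa using congrFun h n)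
    (isInvariantDir_single_of_notMem_vars P hn 1)

/-- **The hypotheses of `card_le_one_of_D_eq_zero` are inconsistent for `T ≠ ∅`** (ours; the finding recorded): `hPT` says the
`T`-variables do not occur in `P`, and then the all-slots pin hypothesis `hPin` fails.  Hence `card_le_one_of_D_eq_zero` and
`card_le_one_of_D_eq_zero_of_surjective_frobenius` are correct but contentless whenever a `W`-variable is present; the `_class`
versions below are the repair. [cite: Lang2002, Ch. IV §1] -/
theorem card_le_one_of_D_eq_zero_hypotheses_inconsistent (P : MvPolynomial ι L) (T : Finset ι) (hT : T.Nonempty)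
    (hPT : ∀ n ∈ T, n ∉ P.vars) (i₀ : ι)
    (hPin : ∀ A A' : Matrix ι ι L, A * A' = 1 → A' * A = 1 → i₀ ∈ (linSubst (fun j k => A j k) P).vars) : False := by
  obtain ⟨n, hn⟩ := hT
  exact false_of_notMem_vars_of_forall_mem_vars_linSubst P (hPT n hn) i₀ hPin

omit [Fintype ι] [DecidableEq ι] in
/-- … and for `T = ∅` the right-inverse hypothesis `hcd` of `card_le_one_of_D_eq_zero` forces the index type `r` of moved slots to be
empty (ours; bookkeeping). [cite: Lang2002, Ch. XIII §4] -/
theorem isEmpty_of_rightInverse_empty {r : Type*} [DecidableEq r] (c : r → ι → L) (d : ι → r → L)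
    (hcd : ∀ a b, ∑ n ∈ (∅ : Finset ι), c a n * d n b = if a = b then (1 : L) else 0) : IsEmpty r :=
  ⟨fun a => by simpa using hcd a a⟩

/-! ## 2. Class-linear matrices and the class-restricted pin condition `(P)_S` -/

omit [Fintype ι] in
/-- `A` is **class-linear on `S`**: it is the identity matrix outside the `S × S` block (ours; these are the coordinate changes the cell's
(P) allows — they respect the weight grading when `S` lies in one weight class, `IsClassLinear.isWeightedHomogeneous_linSubst`).
[cite: Lang2002, Ch. XIII §4] -/
def IsClassLinear (S : Finset ι) (A : Matrix ι ι L) : Prop :=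
  ∀ j k, j ∉ S ∨ k ∉ S → A j k = (1 : Matrix ι ι L) j k

/-- **The class-linear pin condition `(P)_S` at slot `i₀`** (ours; the repaired formal (P)): `X_{i₀}` occurs in `P∘A` for every
invertible CLASS-LINEAR `A`. [cite: Lang2002, Ch. IV §1] -/
def ClassPinned (S : Finset ι) (P : MvPolynomial ι L) (i₀ : ι) : Prop :=
  ∀ A A' : Matrix ι ι L, A * A' = 1 → A' * A = 1 → IsClassLinear S A → i₀ ∈ (linSubst (fun j k => A j k) P).vars

omit [Fintype ι] in
/-- The identity is class-linear (bookkeeping). [cite: Lang2002, Ch. XIII §4] -/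
theorem isClassLinear_one (S : Finset ι) : IsClassLinear S (1 : Matrix ι ι L) := fun _ _ _ => rfl

omit [Fintype ι] in
/-- Every matrix is class-linear on the class of all slots (bookkeeping). [cite: Lang2002, Ch. XIII §4] -/
theorem isClassLinear_univ [Fintype ι] (A : Matrix ι ι L) : IsClassLinear Finset.univ A :=
  fun j k h => by rcases h with h | h <;> exact absurd (Finset.mem_univ _) h

/-- Products of class-linear matrices are class-linear (bookkeeping). [cite: Lang2002, Ch. XIII §4] -/
theorem IsClassLinear.mul {S : Finset ι} {A B : Matrix ι ι L} (hA : IsClassLinear S A) (hB : IsClassLinear S B) :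
    IsClassLinear S (A * B) := by
  intro j k hjk
  rw [Matrix.mul_apply]
  rcases hjk with hj | hk
  · rw [Finset.sum_eq_single j (fun m _ hmj => by rw [hA j m (Or.inl hj), Matrix.one_apply_ne' hmj, zero_mul])
        (fun h => absurd (Finset.mem_univ j) h), hA j j (Or.inl hj), Matrix.one_apply_eq, one_mul, hB j k (Or.inl hj)]
  · rw [Finset.sum_eq_single k (fun m _ hmk => by rw [hB m k (Or.inr hk), Matrix.one_apply_ne hmk, mul_zero])
        (fun h => absurd (Finset.mem_univ k) h), hB k k (Or.inr hk), Matrix.one_apply_eq, mul_one, hA j k (Or.inr hk)]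

/-- The two-sided inverse of a class-linear matrix is class-linear (bookkeeping). [cite: Lang2002, Ch. XIII §4] -/
theorem IsClassLinear.of_inverse {S : Finset ι} {A A' : Matrix ι ι L} (hA : IsClassLinear S A) (h : A * A' = 1)
    (h' : A' * A = 1) : IsClassLinear S A' := by
  intro j k hjk
  rcases hjk with hj | hk
  · have e : (A * A') j k = (1 : Matrix ι ι L) j k := by rw [h]
    rwa [Matrix.mul_apply, Finset.sum_eq_single j (fun m _ hmj => by rw [hA j m (Or.inl hj), Matrix.one_apply_ne' hmj, zero_mul])
      (fun hh => absurd (Finset.mem_univ j) hh), hA j j (Or.inl hj), Matrix.one_apply_eq, one_mul] at e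
  · have e : (A' * A) j k = (1 : Matrix ι ι L) j k := by rw [h']
    rwa [Matrix.mul_apply, Finset.sum_eq_single k (fun m _ hmk => by rw [hA m k (Or.inr hk), Matrix.one_apply_ne hmk, mul_zero])
      (fun hh => absurd (Finset.mem_univ k) hh), hA k k (Or.inr hk), Matrix.one_apply_eq, mul_one] at e

omit [Fintype ι] in
/-- A column of a class-linear matrix indexed inside the class is supported in the class (bookkeeping). [cite: Lang2002, Ch. XIII §4] -/
theorem IsClassLinear.apply_eq_zero_of_notMem {S : Finset ι} {A : Matrix ι ι L} (hA : IsClassLinear S A) {i : ι} (hi : i ∈ S)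
    {j : ι} (hj : j ∉ S) : A j i = 0 := by
  rw [hA j i (Or.inl hj), Matrix.one_apply_ne]
  rintro rfl
  exact hj hi

omit [Fintype ι] in
/-- Transvections inside the class are class-linear (bookkeeping). [cite: Lang2002, Ch. XIII §4] -/
theorem isClassLinear_transvection {S : Finset ι} {i j : ι} (hi : i ∈ S) (hj : j ∈ S) (c : L) :
    IsClassLinear S (Matrix.transvection i j c) := by
  intro a b hab
  rw [Matrix.transvection, Matrix.add_apply, Matrix.single_apply_of_ne, add_zero]
  rintro ⟨rfl, rfl⟩
  rcases hab with ha | hb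
  · exact ha hi
  · exact hb hj

omit [Fintype ι] in
/-- Replacing column `i ∈ S` of the identity by a vector supported in `S` gives a class-linear matrix (bookkeeping).
[cite: Lang2002, Ch. XIII §4] -/
theorem isClassLinear_updateCol_one {S : Finset ι} {i : ι} (hi : i ∈ S) {u : ι → L} (hu : ∀ j, j ∉ S → u j = 0) :
    IsClassLinear S ((1 : Matrix ι ι L).updateCol i u) := by
  intro a b hab
  rw [Matrix.updateCol_apply]
  split_ifs with hb
  · subst hb
    have ha : a ∉ S := hab.resolve_right fun h => h hi
    rw [hu a ha, Matrix.one_apply_ne]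
    rintro rfl
    exact ha hi
  · rfl

/-- **The class GL-move `v ↦ e_i`** (ours, elementary): a non-zero vector supported in the class `S` is the `i`-th column (`i ∈ S`) of an
invertible CLASS-LINEAR matrix (the identity with column `i` replaced by `v`, corrected by one transvection inside `S` when `v_i = 0`).
[cite: Lang2002, Ch. XIII §4] -/
theorem exists_classLinear_col_eq {S : Finset ι} (v : ι → L) (hv : v ≠ 0) (hvS : ∀ j, j ∉ S → v j = 0) {i : ι} (hi : i ∈ S) :
    ∃ A A' : Matrix ι ι L, A * A' = 1 ∧ A' * A = 1 ∧ IsClassLinear S A ∧ ∀ r, A r i = v r := by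
  have finish : ∀ A : Matrix ι ι L, A.det ≠ 0 → IsClassLinear S A → (∀ r, A r i = v r) →
      ∃ A A' : Matrix ι ι L, A * A' = 1 ∧ A' * A = 1 ∧ IsClassLinear S A ∧ ∀ r, A r i = v r := fun A hA hcl hcol =>
    ⟨A, A⁻¹, Matrix.mul_nonsing_inv A (isUnit_iff_ne_zero.mpr hA), Matrix.nonsing_inv_mul A (isUnit_iff_ne_zero.mpr hA), hcl, hcol⟩
  obtain ⟨j₀, hj₀⟩ := Function.ne_iff.mp hv
  rw [Pi.zero_apply] at hj₀
  have hj₀S : j₀ ∈ S := by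
    by_contra h
    exact hj₀ (hvS j₀ h)
  by_cases hji : j₀ = i
  · subst hji
    exact finish ((1 : Matrix ι ι L).updateCol j₀ v) (by rw [det_updateCol_one]; exact hj₀) (isClassLinear_updateCol_one hj₀S hvS)
      fun r => Matrix.updateCol_self
  · set v' : ι → L := Function.update v i (v j₀) with hv'
    have hv'S : ∀ j, j ∉ S → v' j = 0 := fun j hj => by
      have hji' : j ≠ i := by
        rintro rfl
        exact hj hi
      rw [hv', Function.update_of_ne hji', hvS j hj]
    set B : Matrix ι ι L := (1 : Matrix ι ι L).updateCol i v' with hB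
    have hBcol : ∀ r, B r i = v' r := fun r => Matrix.updateCol_self
    refine finish (Matrix.transvection i j₀ ((v i - v j₀) / v j₀) * B) ?_
      ((isClassLinear_transvection hi hj₀S _).mul (isClassLinear_updateCol_one hi hv'S)) fun r => ?_
    · rw [Matrix.det_mul, Matrix.det_transvection_of_ne i j₀ (Ne.symm hji), one_mul, hB, det_updateCol_one, hv',
        Function.update_self]
      exact hj₀
    · by_cases hr : r = i
      · rw [hr, Matrix.transvection_mul_apply_same i j₀ i _ B, hBcol, hBcol, hv', Function.update_self, Function.update_of_ne hji]
        field_simp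
        ring
      · rw [Matrix.transvection_mul_apply_of_ne i j₀ r i hr _ B, hBcol, hv', Function.update_of_ne hr]

/-- **`(P)_S` ⇒ no invariant direction inside the class** (ours; the repaired form of `not_isInvariantDir_of_forall_mem_vars`): if `X_{i₀}`
(`i₀ ∈ S`) occurs in `P∘A` for every invertible class-linear `A`, then `P` has no non-zero invariant direction supported in `S`.
[cite: Lang2002, Ch. IV §1] -/
theorem ClassPinned.not_isInvariantDir {S : Finset ι} {P : MvPolynomial ι L} {i₀ : ι} (hP : ClassPinned S P i₀) (hi₀ : i₀ ∈ S)
    {v : ι → L} (hv : v ≠ 0) (hvS : ∀ j, j ∉ S → v j = 0) : ¬ IsInvariantDir P v := by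
  obtain ⟨A, A', hA, hA', hcl, hcol⟩ := exists_classLinear_col_eq v hv hvS hi₀
  have h := (mem_vars_linSubst_iff (fun j k => A j k) (linSubst_injective_of_mul_eq_one A A' hA) P i₀).mp (hP A A' hA hA' hcl)
  rwa [show (fun j => A j i₀) = v from funext hcol] at h

/-- **No invariant direction inside the class ⇒ `(P)_S`** (ours; the converse): the column `i₀ ∈ S` of an invertible class-linear matrix
is a non-zero vector supported in `S`. [cite: Lang2002, Ch. IV §1] -/
theorem classPinned_of_forall_not_isInvariantDir {S : Finset ι} {P : MvPolynomial ι L} {i₀ : ι} (hi₀ : i₀ ∈ S)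
    (hF : ∀ v : ι → L, v ≠ 0 → (∀ j, j ∉ S → v j = 0) → ¬ IsInvariantDir P v) : ClassPinned S P i₀ :=
  fun A A' hA hA' hcl =>
    (mem_vars_linSubst_iff (fun j k => A j k) (linSubst_injective_of_mul_eq_one A A' hA) P i₀).mpr
      (hF _ (col_ne_zero_of_mul_eq_one A A' hA' i₀) fun _ hj => hcl.apply_eq_zero_of_notMem hi₀ hj)

/-- **Dictionary `(P)_S ⇔ no invariant direction in the class`** (REMARK D made class-local; ours). [cite: Lang2002, Ch. IV §1] -/
theorem classPinned_iff_forall_not_isInvariantDir {S : Finset ι} {P : MvPolynomial ι L} {i₀ : ι} (hi₀ : i₀ ∈ S) :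
    ClassPinned S P i₀ ↔ ∀ v : ι → L, v ≠ 0 → (∀ j, j ∉ S → v j = 0) → ¬ IsInvariantDir P v :=
  ⟨fun h _ hv hvS => h.not_isInvariantDir hi₀ hv hvS, classPinned_of_forall_not_isInvariantDir hi₀⟩

/-- The tested slot is immaterial inside the class (ours; bookkeeping). [cite: Lang2002, Ch. IV §1] -/
theorem classPinned_iff_classPinned {S : Finset ι} {P : MvPolynomial ι L} {i₀ i₁ : ι} (hi₀ : i₀ ∈ S) (hi₁ : i₁ ∈ S) :
    ClassPinned S P i₀ ↔ ClassPinned S P i₁ := by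
  rw [classPinned_iff_forall_not_isInvariantDir hi₀, classPinned_iff_forall_not_isInvariantDir hi₁]

/-- On the class of ALL slots, `(P)_univ` is the all-slots hypothesis of `card_le_one_of_D_eq_zero` (ours; bookkeeping — so the originals
are the special case `Scl = univ` of the `_class` versions below). [cite: Lang2002, Ch. IV §1] -/
theorem classPinned_univ_iff (P : MvPolynomial ι L) (i₀ : ι) :
    ClassPinned Finset.univ P i₀ ↔
      ∀ A A' : Matrix ι ι L, A * A' = 1 → A' * A = 1 → i₀ ∈ (linSubst (fun j k => A j k) P).vars :=
  ⟨fun h A A' hA hA' => h A A' hA hA' (isClassLinear_univ A), fun h A A' hA hA' _ => h A A' hA hA'⟩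

/-- **The singleton class: `(P)_{{i}}` at `i` says exactly that `X_i` occurs in `P`** (ours) — in particular the class-linear pin
condition is satisfiable (e.g. by `P = X_i^p`), unlike the all-slots one. [cite: Lang2002, Ch. IV §1] -/
theorem classPinned_singleton_iff (P : MvPolynomial ι L) (i : ι) : ClassPinned {i} P i ↔ i ∈ P.vars := by
  rw [classPinned_iff_forall_not_isInvariantDir (Finset.mem_singleton_self i)]
  constructor
  · intro h
    by_contra hi
    exact h (Pi.single i 1) (fun h0 => by simpa using congrFun h0 i)
      (fun j hj => by rw [Pi.single_apply, if_neg fun hji => hj (Finset.mem_singleton.mpr hji)])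
      (isInvariantDir_single_of_notMem_vars P hi 1)
  · intro hi v hv hvS hinv
    have hvj : ∀ j, j ≠ i → v j = 0 := fun j hj => hvS j fun hjS => hj (Finset.mem_singleton.mp hjS)
    have hvi : v i ≠ 0 := by
      intro h0
      apply hv
      funext j
      by_cases hj : j = i
      · rw [hj, h0, Pi.zero_apply]
      · exact hvj j hj
    have hv_eq : v = Pi.single i (v i) := by
      funext j
      by_cases hj : j = i
      · rw [hj, Pi.single_eq_same]
      · rw [Pi.single_apply, if_neg hj, hvj j hj]
    rw [hv_eq, isInvariantDir_single_iff P i hvi] at hinv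
    exact hinv hi

/-- **Transport**: `(P)_S` is stable under invertible class-linear substitutions `P ↦ P∘B` (ours; `(P∘B)∘A = P∘(B·A)`).
[cite: Lang2002, Ch. IV §1] -/
theorem ClassPinned.map_linSubst {S : Finset ι} {P : MvPolynomial ι L} {i₀ : ι} (hP : ClassPinned S P i₀) {B B' : Matrix ι ι L}
    (hB : B * B' = 1) (hB' : B' * B = 1) (hcl : IsClassLinear S B) : ClassPinned S (linSubst (fun j k => B j k) P) i₀ := by
  intro A A' hA hA' hclA
  rw [linSubst_linSubst]
  refine hP (B * A) (A' * B') ?_ ?_ (hcl.mul hclA)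
  · rw [Matrix.mul_assoc, ← Matrix.mul_assoc A, hA, Matrix.one_mul, hB]
  · rw [Matrix.mul_assoc, ← Matrix.mul_assoc B', hB', Matrix.one_mul, hA']

/-- **Class-linear substitutions are graded** (ours; bookkeeping): if all slots of `S` have the same weight, `P ↦ P∘A` for class-linear `A`
preserves weighted homogeneity and the weight. [cite: AbramovichTemkinWlodarczyk2024, §5.1] -/
theorem IsClassLinear.isWeightedHomogeneous_linSubst {M : Type*} [AddCommMonoid M] {w : ι → M} {S : Finset ι} {A : Matrix ι ι L}
    (hA : IsClassLinear S A) (hS : ∀ j ∈ S, ∀ k ∈ S, w j = w k) {P : MvPolynomial ι L} {μ : M}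
    (hP : IsWeightedHomogeneous w P μ) : IsWeightedHomogeneous w (linSubst (fun j k => A j k) P) μ := by
  have hX : ∀ j, IsWeightedHomogeneous w (∑ k, C (A j k) * X k : MvPolynomial ι L) (w j) := by
    intro j
    refine IsWeightedHomogeneous.sum _ _ _ fun k _ => ?_
    by_cases hjk : A j k = 0
    · rw [hjk, C_0, zero_mul]
      exact isWeightedHomogeneous_zero L w _
    · have hw : w k = w j := by
        by_cases hj : j ∈ S
        · by_cases hk : k ∈ S
          · exact (hS j hj k hk).symm
          · exact absurd (hA.apply_eq_zero_of_notMem hj hk ▸ rfl : A k j = A k j) fun _ => hjk (by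
              rw [hA j k (Or.inr hk), Matrix.one_apply_ne]
              rintro rfl
              exact hk hj)
        · have hkj : k = j := by
            by_contra hkj
            exact hjk (by rw [hA j k (Or.inl hj), Matrix.one_apply_ne' hkj])
          rw [hkj]
      rw [← hw]
      exact (isWeightedHomogeneous_X L w k).C_mul _
  classical
  have hexp : linSubst (fun j k => A j k) P = ∑ d ∈ P.support, C (coeff d P) * ∏ i ∈ d.support, (∑ k, C (A i k) * X k) ^ d i := by
    rw [linSubst, MvPolynomial.aeval_def, MvPolynomial.eval₂_eq]
    simp only [MvPolynomial.algebraMap_eq]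
  rw [hexp]
  refine IsWeightedHomogeneous.sum _ _ _ fun d hd => ?_
  have hwd : Finsupp.weight w d = μ := hP (mem_support_iff.mp hd)
  have hπ : IsWeightedHomogeneous w (∏ i ∈ d.support, (∑ k, C (A i k) * X k : MvPolynomial ι L) ^ d i)
      (∑ i ∈ d.support, d i • w i) :=
    IsWeightedHomogeneous.prod _ _ _ fun i _ => (hX i).pow (d i)
  have hs : ∑ i ∈ d.support, d i • w i = μ := by rw [← hwd, Finsupp.weight_apply, Finsupp.sum]
  rw [hs] at hπ
  exact hπ.C_mul _

/-! ## 3. The rank-one chain under the class-linear pin condition -/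

/-- **THEOREM B⁗ (i) RANK ONE under `(P)_S`** (repaired form of `card_le_one_of_forall_mem_vars`; ours as a formal statement): over a field of
characteristic `p`, if the diagonal coefficients on `S` are `p`-th powers, `P₀` is free of the `S`-variables, and `X_{i₀}` (`i₀` in a class
`Scl ⊇ S`) occurs in `(Σ_{i∈S} a_i X_i^p + P₀)∘A` for every invertible CLASS-LINEAR `A`, then `|S| ≤ 1`. [cite: Lang2002, Ch. V §6] -/
theorem card_le_one_of_forall_mem_vars_class (p : ℕ) [Fact p.Prime] [CharP L p] (S : Finset ι) (a b : ι → L)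
    (hb : ∀ i ∈ S, b i ^ p = a i) (P₀ : MvPolynomial ι L) (hP₀ : ∀ i ∈ S, i ∉ P₀.vars) (Scl : Finset ι) (hScl : S ⊆ Scl) {i₀ : ι}
    (hi₀ : i₀ ∈ Scl) (hP : ClassPinned Scl (∑ i ∈ S, C (a i) * X i ^ p + P₀) i₀) : S.card ≤ 1 := by
  by_contra hS
  obtain ⟨v, hv0, hvS, hv⟩ := exists_isInvariantDir_of_two_le_card p S (by omega) a b hb P₀ hP₀
  exact hP.not_isInvariantDir hi₀ hv0 (fun j hj => hvS j fun hjS => hj (hScl hjS)) hv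

/-- **RANK ONE with Frobenius splitting derived, under `(P)_S`** (repaired form of `card_le_one_of_pderiv_eq_zero`; ours): `P` weighted
homogeneous of weight `μ` (positive weights), `p·w_i = μ` and `∂_i P = 0` on `S`, `p`-th roots `b_i` of the diagonal coefficients, and
`(P)_{Scl}` at some `i₀ ∈ Scl ⊇ S` ⇒ `|S| ≤ 1`. [cite: Lang2002, Ch. V §6] -/
theorem card_le_one_of_pderiv_eq_zero_class (p : ℕ) [Fact p.Prime] [CharP L p] {w : ι → ℚ} (hw : ∀ j, 0 < w j) {μ : ℚ}
    {P : MvPolynomial ι L} (hP : IsWeightedHomogeneous w P μ) (S : Finset ι) (hS : ∀ i ∈ S, (p : ℚ) * w i = μ)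
    (hD : ∀ i ∈ S, pderiv i P = 0) (b : ι → L) (hb : ∀ i ∈ S, b i ^ p = P.coeff (Finsupp.single i p)) (Scl : Finset ι)
    (hScl : S ⊆ Scl) {i₀ : ι} (hi₀ : i₀ ∈ Scl) (hPin : ClassPinned Scl P i₀) : S.card ≤ 1 := by
  obtain ⟨hP₀, hsplit⟩ := eq_sum_frobenius_add p hw hP S hS hD
  refine card_le_one_of_forall_mem_vars_class p S (fun i => P.coeff (Finsupp.single i p)) b hb _ hP₀ Scl hScl hi₀ ?_
  rw [← hsplit]
  exact hPin

/-- **THEOREM B⁗ (i) RANK ONE from `D P = 0`, under `(P)_S`** (repaired form of `card_le_one_of_D_eq_zero`; ours as a formal statement):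
`D = Σ_a ℓ_a(W)·∂_{f_a}` with independent linear forms `ℓ_a` in the `W`-variables `T` (right inverse `d`), distinct moved slots `f_a` of
weight `μ/p` inside a class `Scl`, `P` weighted homogeneous of weight `μ` and free of the `T`-variables with `D P = 0`, `p`-th roots of the
diagonal coefficients given, and the CLASS-LINEAR pin condition at some `i₀ ∈ Scl` — then at most ONE slot is moved (`r ≤ 1`).  Unlike the
original, these hypotheses are jointly satisfiable with `T ≠ ∅` (witness at the end of the file). [cite: Lang2002, Ch. V §6] -/
theorem card_le_one_of_D_eq_zero_class (p : ℕ) [Fact p.Prime] [CharP L p] {r : Type*} [Fintype r] [DecidableEq r] {w : ι → ℚ}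
    (hw : ∀ j, 0 < w j) {μ : ℚ} {P : MvPolynomial ι L} (hP : IsWeightedHomogeneous w P μ) (T : Finset ι)
    (hPT : ∀ n ∈ T, n ∉ P.vars) (f : r → ι) (hf : Function.Injective f) (hfw : ∀ a, (p : ℚ) * w (f a) = μ)
    (c : r → ι → L) (d : ι → r → L) (hcd : ∀ a b, ∑ n ∈ T, c a n * d n b = if a = b then (1 : L) else 0)
    (hDP : ∑ a, (∑ n ∈ T, C (c a n) * X n) * pderiv (f a) P = 0)
    (b : r → L) (hb : ∀ a, b a ^ p = P.coeff (Finsupp.single (f a) p)) (Scl : Finset ι) (hScl : ∀ a, f a ∈ Scl) {i₀ : ι}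
    (hi₀ : i₀ ∈ Scl) (hPin : ClassPinned Scl P i₀) : Fintype.card r ≤ 1 := by
  have hQ : ∀ a, pderiv (f a) P = 0 :=
    eq_zero_of_sum_linearForm_mul T c d hcd (fun a => pderiv (f a) P) (fun a n hn => notMem_vars_pderiv (f a) (hPT n hn)) hDP
  have hcard : (Finset.univ.image f).card = Fintype.card r := by
    rw [Finset.card_image_of_injective _ hf, Finset.card_univ]
  rw [← hcard]
  refine card_le_one_of_pderiv_eq_zero_class p hw hP (Finset.univ.image f) (fun i hi => ?_) (fun i hi => ?_)
    (Function.extend f b 0) (fun i hi => ?_) Scl (fun i hi => ?_) hi₀ hPin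
  · obtain ⟨a, -, rfl⟩ := Finset.mem_image.mp hi
    exact hfw a
  · obtain ⟨a, -, rfl⟩ := Finset.mem_image.mp hi
    exact hQ a
  · obtain ⟨a, -, rfl⟩ := Finset.mem_image.mp hi
    rw [hf.extend_apply]
    exact hb a
  · obtain ⟨a, -, rfl⟩ := Finset.mem_image.mp hi
    exact hScl a

/-- **RANK ONE over a field with surjective Frobenius, under `(P)_S`** (repaired form of `card_le_one_of_D_eq_zero_of_surjective_frobenius`;
ours): the root data are automatic when every element of `L` is a `p`-th power.  INSTRUMENT for engine 1's `W(f)` toy model, NOT a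
resolution theorem. [cite: AbramovichTemkinWlodarczyk2024, §5.1; Lang2002, Ch. V §6] -/
theorem card_le_one_of_D_eq_zero_of_surjective_frobenius_class (p : ℕ) [Fact p.Prime] [CharP L p] {r : Type*} [Fintype r]
    [DecidableEq r] (hperf : ∀ x : L, ∃ y : L, y ^ p = x) {w : ι → ℚ} (hw : ∀ j, 0 < w j) {μ : ℚ} {P : MvPolynomial ι L}
    (hP : IsWeightedHomogeneous w P μ) (T : Finset ι) (hPT : ∀ n ∈ T, n ∉ P.vars) (f : r → ι) (hf : Function.Injective f)
    (hfw : ∀ a, (p : ℚ) * w (f a) = μ) (c : r → ι → L) (d : ι → r → L)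
    (hcd : ∀ a b, ∑ n ∈ T, c a n * d n b = if a = b then (1 : L) else 0)
    (hDP : ∑ a, (∑ n ∈ T, C (c a n) * X n) * pderiv (f a) P = 0) (Scl : Finset ι) (hScl : ∀ a, f a ∈ Scl) {i₀ : ι}
    (hi₀ : i₀ ∈ Scl) (hPin : ClassPinned Scl P i₀) : Fintype.card r ≤ 1 :=
  card_le_one_of_D_eq_zero_class p hw hP T hPT f hf hfw c d hcd hDP (fun a => (hperf (P.coeff (Finsupp.single (f a) p))).choose)
    (fun a => (hperf (P.coeff (Finsupp.single (f a) p))).choose_spec) Scl hScl hi₀ hPin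

/-! ## 4. Consistency witness: every hypothesis of `card_le_one_of_D_eq_zero_class` met with `T ≠ ∅` -/

/-- **Consistency witness** (ours; numbers, not adjectives): over `𝔽₂`, slots `ι = Fin 2` with `0` the moved `f`-slot (weight `1/2`) and
`1` a `W`-slot (weight `1/4`, so `T = {1} ≠ ∅`), `P = X_0^2` (weight `1`, `W`-free), `D = X_1·∂_0` (`D P = 2 X_1 X_0 = 0`), class
`Scl = {0}` with `(P)_{{0}}` by `classPinned_singleton_iff`: all hypotheses of `card_le_one_of_D_eq_zero_class` hold — the repaired
hypothesis set is consistent where the original (`card_le_one_of_D_eq_zero_hypotheses_inconsistent`) is not. [cite: Lang2002, Ch. V §6] -/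
theorem card_le_one_of_D_eq_zero_class_consistent : Fintype.card Unit ≤ 1 := by
  have hvars : (X (0 : Fin 2) ^ 2 : MvPolynomial (Fin 2) (ZMod 2)).vars = {0} := by
    rw [X_pow_eq_monomial, vars_monomial one_ne_zero, Finsupp.support_single _ two_ne_zero]
  refine card_le_one_of_D_eq_zero_class (ι := Fin 2) (L := ZMod 2) 2 (w := ![1 / 2, 1 / 4]) (fun j => ?_) (μ := 1)
    (P := X 0 ^ 2) ?_ {1} (fun n hn => ?_) (fun _ : Unit => 0) (fun _ _ _ => Subsingleton.elim _ _) (fun _ => ?_)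
    (fun _ _ => 1) (fun _ _ => 1) (fun a b => ?_) ?_ (fun _ => 1) (fun _ => ?_) {0} (fun _ => Finset.mem_singleton_self 0)
    (Finset.mem_singleton_self 0) ((classPinned_singleton_iff _ _).mpr ?_)
  · fin_cases j <;> simp
  · simpa using (isWeightedHomogeneous_X (ZMod 2) ![(1 : ℚ) / 2, 1 / 4] (0 : Fin 2)).pow 2
  · rw [Finset.mem_singleton] at hn
    rw [hn, hvars]
    decide
  · simp
  · simp
  · have h2 : ((2 : ℕ) : ZMod 2) = 0 := by decide
    have hder : pderiv (0 : Fin 2) (X 0 ^ 2 : MvPolynomial (Fin 2) (ZMod 2)) = 0 := by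
      rw [X_pow_eq_monomial, pderiv_monomial, Finsupp.single_eq_same, h2, mul_zero, map_zero]
    simp [hder]
  · simp [X_pow_eq_monomial]
  · rw [hvars]
    exact Finset.mem_singleton_self 0

/-! ## 5. The INTRINSIC rank-one step: no change of the `f`-basis on the automorphism side

THEOREM F STEP 4 receives `D = E₁ = Σ_{i∈S} M_i(W)·∂_i` with ARBITRARY linear forms `M_i = Σ_{n∈T} c_{in} X_n` (not pre-normalised to
independent ones).  Extracting the coefficient of `X_n` from `D P = 0` shows that every column `(c_{in})_i` is an order-one NULL DIRECTION
of `P` (`dirDeriv (c_{·n}) P = 0`); two independent null directions inside the class are moved to two coordinate slots by ONE class-linear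
change of coordinates ON `P` (`exists_classLinear_col_eq_two`, the chain rule `pderiv_linSubst`, transport of `(P)_S`), where
`card_le_one_of_pderiv_eq_zero_class` forbids them.  Hence all columns are proportional: `c_{in} = v_i·λ_n`, i.e. `D = λ(W)·∂_v`
(`exists_rank_one_of_D_eq_zero_class`). -/

omit [DecidableEq ι] in
/-- The directional derivative along a constant vector `u`: `∂_u P = Σ_j u_j ∂_j P` (ours; bookkeeping). [cite: Lang2002, Ch. IV §1] -/
noncomputable def dirDeriv (u : ι → L) (P : MvPolynomial ι L) : MvPolynomial ι L := ∑ j, C (u j) * pderiv j P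

omit [DecidableEq ι] in
/-- `∂_u` kills constants (bookkeeping). [cite: Lang2002, Ch. IV §1] -/
theorem dirDeriv_C (u : ι → L) (a : L) : dirDeriv u (C a : MvPolynomial ι L) = 0 := by
  simp [dirDeriv]

omit [DecidableEq ι] in
/-- `∂_u` is additive (bookkeeping). [cite: Lang2002, Ch. IV §1] -/
theorem dirDeriv_add (u : ι → L) (P Q : MvPolynomial ι L) : dirDeriv u (P + Q) = dirDeriv u P + dirDeriv u Q := by
  simp [dirDeriv, mul_add, Finset.sum_add_distrib]

omit [DecidableEq ι] in
/-- Leibniz rule for `∂_u` (bookkeeping). [cite: Lang2002, Ch. IV §1] -/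
theorem dirDeriv_mul (u : ι → L) (P Q : MvPolynomial ι L) : dirDeriv u (P * Q) = dirDeriv u P * Q + P * dirDeriv u Q := by
  simp only [dirDeriv, pderiv_mul, mul_add, Finset.sum_add_distrib, Finset.sum_mul, Finset.mul_sum]
  congr 1 <;> exact Finset.sum_congr rfl fun j _ => by ring

omit [DecidableEq ι] in
/-- `∂_u X_j = u_j` (bookkeeping). [cite: Lang2002, Ch. IV §1] -/
theorem dirDeriv_X (u : ι → L) (j : ι) : dirDeriv u (X j : MvPolynomial ι L) = C (u j) := by
  rw [dirDeriv, Finset.sum_eq_single j (fun j' _ hj' => by rw [pderiv_X_of_ne (Ne.symm hj'), mul_zero])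
    (fun h => absurd (Finset.mem_univ j) h), pderiv_X_self, mul_one]

/-- `∂_u` is zero along the zero vector off the support: if `u` vanishes wherever it is tested … (bookkeeping): `∂_{e_i} = ∂_i`.
[cite: Lang2002, Ch. IV §1] -/
theorem dirDeriv_single (i : ι) (P : MvPolynomial ι L) : dirDeriv (Pi.single i 1) P = pderiv i P := by
  rw [dirDeriv, Finset.sum_eq_single i (fun j _ hj => by rw [Pi.single_apply, if_neg hj, C_0, zero_mul])
    (fun h => absurd (Finset.mem_univ i) h), Pi.single_eq_same, C_1, one_mul]

omit [DecidableEq ι] in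
/-- **Chain rule for linear substitutions** (ours; bookkeeping): `∂_i (P∘A) = (∂_{A e_i} P)∘A`, the column `A e_i = (A_{ji})_j`.
[cite: Lang2002, Ch. IV §1] -/
theorem pderiv_linSubst (A : Matrix ι ι L) (i : ι) (P : MvPolynomial ι L) :
    pderiv i (linSubst (fun j k => A j k) P) = linSubst (fun j k => A j k) (dirDeriv (fun j => A j i) P) := by
  induction P using MvPolynomial.induction_on with
  | C a => rw [dirDeriv_C, map_zero, MvPolynomial.algHom_C, MvPolynomial.algebraMap_eq, pderiv_C]
  | add p q hp hq => rw [map_add, map_add, hp, hq, dirDeriv_add, map_add]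
  | mul_X p j hp =>
    have hXj : pderiv i (linSubst (fun j k => A j k) (X j : MvPolynomial ι L)) = C (A j i) := by
      rw [linSubst_X, map_sum, Finset.sum_eq_single i (fun k _ hk => by rw [pderiv_C_mul, pderiv_X_of_ne hk, mul_zero])
        (fun h => absurd (Finset.mem_univ i) h), pderiv_C_mul, pderiv_X_self, mul_one]
    rw [map_mul, pderiv_mul, hp, hXj, dirDeriv_mul, dirDeriv_X, map_add, map_mul, map_mul, MvPolynomial.algHom_C,
      MvPolynomial.algebraMap_eq]

/-- **The class GL-move fixing prescribed slots** (ours, elementary): a vector `v` supported in the class `S` with a non-zero entry at some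
`j₀ ∉ F` is the `i`-th column (`i ∈ S ∖ F`) of an invertible class-linear matrix whose columns indexed by `F` are the unit vectors.
[cite: Lang2002, Ch. XIII §4] -/
theorem exists_classLinear_col_eq_fixing {S : Finset ι} (F : Finset ι) (v : ι → L) (hvS : ∀ j, j ∉ S → v j = 0) {j₀ : ι}
    (hj₀F : j₀ ∉ F) (hvj₀ : v j₀ ≠ 0) {i : ι} (hi : i ∈ S) (hiF : i ∉ F) :
    ∃ A A' : Matrix ι ι L, A * A' = 1 ∧ A' * A = 1 ∧ IsClassLinear S A ∧ (∀ r, A r i = v r) ∧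
      ∀ m ∈ F, ∀ r, A r m = (1 : Matrix ι ι L) r m := by
  have hj₀S : j₀ ∈ S := by
    by_contra h
    exact hvj₀ (hvS j₀ h)
  have finish : ∀ A : Matrix ι ι L, A.det ≠ 0 → IsClassLinear S A → (∀ r, A r i = v r) →
      (∀ m ∈ F, ∀ r, A r m = (1 : Matrix ι ι L) r m) →
      ∃ A A' : Matrix ι ι L, A * A' = 1 ∧ A' * A = 1 ∧ IsClassLinear S A ∧ (∀ r, A r i = v r) ∧
        ∀ m ∈ F, ∀ r, A r m = (1 : Matrix ι ι L) r m := fun A hA hcl hcol hfix =>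
    ⟨A, A⁻¹, Matrix.mul_nonsing_inv A (isUnit_iff_ne_zero.mpr hA), Matrix.nonsing_inv_mul A (isUnit_iff_ne_zero.mpr hA), hcl, hcol,
      hfix⟩
  by_cases hji : j₀ = i
  · subst hji
    refine finish ((1 : Matrix ι ι L).updateCol j₀ v) (by rw [det_updateCol_one]; exact hvj₀) (isClassLinear_updateCol_one hj₀S hvS)
      (fun r => Matrix.updateCol_self) fun m hm r => ?_
    have hmj : m ≠ j₀ := by
      rintro rfl
      exact hj₀F hm
    rw [Matrix.updateCol_ne hmj]
  · set v' : ι → L := Function.update v i (v j₀) with hv'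
    have hv'S : ∀ j, j ∉ S → v' j = 0 := fun j hj => by
      have hji' : j ≠ i := by
        rintro rfl
        exact hj hi
      rw [hv', Function.update_of_ne hji', hvS j hj]
    set B : Matrix ι ι L := (1 : Matrix ι ι L).updateCol i v' with hB
    have hBcol : ∀ r, B r i = v' r := fun r => Matrix.updateCol_self
    have hBfix : ∀ m ∈ F, ∀ r, B r m = (1 : Matrix ι ι L) r m := fun m hm r => by
      have hmi : m ≠ i := by
        rintro rfl
        exact hiF hm
      rw [hB, Matrix.updateCol_ne hmi]
    refine finish (Matrix.transvection i j₀ ((v i - v j₀) / v j₀) * B) ?_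
      ((isClassLinear_transvection hi hj₀S _).mul (isClassLinear_updateCol_one hi hv'S)) (fun r => ?_) fun m hm r => ?_
    · rw [Matrix.det_mul, Matrix.det_transvection_of_ne i j₀ (Ne.symm hji), one_mul, hB, det_updateCol_one, hv',
        Function.update_self]
      exact hvj₀
    · by_cases hr : r = i
      · rw [hr, Matrix.transvection_mul_apply_same i j₀ i _ B, hBcol, hBcol, hv', Function.update_self, Function.update_of_ne hji]
        field_simp
        ring
      · rw [Matrix.transvection_mul_apply_of_ne i j₀ r i hr _ B, hBcol, hv', Function.update_of_ne hr]
    · have hmj : m ≠ j₀ := by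
        rintro rfl
        exact hj₀F hm
      have hmi : m ≠ i := by
        rintro rfl
        exact hiF hm
      by_cases hr : r = i
      · rw [hr, Matrix.transvection_mul_apply_same i j₀ m _ B, hBfix m hm, hBfix m hm, Matrix.one_apply_ne (Ne.symm hmi),
          Matrix.one_apply_ne (Ne.symm hmj), mul_zero, add_zero]
      · rw [Matrix.transvection_mul_apply_of_ne i j₀ r m hr _ B, hBfix m hm]

/-- **The two-column class GL-move** (ours, elementary): two linearly independent vectors supported in the class `S` are the columns
`i₁ ≠ i₂` (both in `S`) of one invertible class-linear matrix. [cite: Lang2002, Ch. XIII §4] -/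
theorem exists_classLinear_col_eq_two {S : Finset ι} (u u' : ι → L) (huS : ∀ j, j ∉ S → u j = 0) (hu'S : ∀ j, j ∉ S → u' j = 0)
    (hu : u ≠ 0) (hind : ∀ c : L, u' ≠ c • u) {i₁ i₂ : ι} (hi₁ : i₁ ∈ S) (hi₂ : i₂ ∈ S) (h12 : i₁ ≠ i₂) :
    ∃ A A' : Matrix ι ι L, A * A' = 1 ∧ A' * A = 1 ∧ IsClassLinear S A ∧ (∀ r, A r i₁ = u r) ∧ ∀ r, A r i₂ = u' r := by
  obtain ⟨A₁, A₁', h₁, h₁', hcl₁, hcol₁⟩ := exists_classLinear_col_eq u hu huS hi₁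
  have hcl₁' : IsClassLinear S A₁' := hcl₁.of_inverse h₁ h₁'
  -- pull `u'` back along `A₁`
  set u'' : ι → L := A₁'.mulVec u' with hu''
  have hA₁u'' : A₁.mulVec u'' = u' := by rw [hu'', Matrix.mulVec_mulVec, h₁, Matrix.one_mulVec]
  have hu''S : ∀ j, j ∉ S → u'' j = 0 := by
    intro j hj
    simp only [hu'', Matrix.mulVec, dotProduct]
    rw [Finset.sum_eq_single j (fun k _ hkj => by rw [hcl₁' j k (Or.inl hj), Matrix.one_apply_ne' hkj, zero_mul])
      (fun h => absurd (Finset.mem_univ j) h), hcl₁' j j (Or.inl hj), Matrix.one_apply_eq, one_mul, hu'S j hj]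
  -- `u''` is not a multiple of `e_{i₁}` (else `u' = A₁ u''` would be a multiple of `u = A₁ e_{i₁}`)
  have hj₀ : ∃ j₀, j₀ ≠ i₁ ∧ u'' j₀ ≠ 0 := by
    by_contra hcon
    push Not at hcon
    apply hind (u'' i₁)
    funext r
    rw [← hA₁u'', Pi.smul_apply, smul_eq_mul]
    simp only [Matrix.mulVec, dotProduct]
    rw [Finset.sum_eq_single i₁ (fun k _ hk => by rw [hcon k hk, mul_zero]) (fun h => absurd (Finset.mem_univ i₁) h), hcol₁ r,
      mul_comm]
  obtain ⟨j₀, hj₀i, hj₀u⟩ := hj₀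
  obtain ⟨A₂, A₂', h₂, h₂', hcl₂, hcol₂, hfix₂⟩ := exists_classLinear_col_eq_fixing {i₁} u'' hu''S
    (show j₀ ∉ ({i₁} : Finset ι) from fun h => hj₀i (Finset.mem_singleton.mp h)) hj₀u hi₂
    (show i₂ ∉ ({i₁} : Finset ι) from fun h => h12 (Finset.mem_singleton.mp h).symm)
  refine ⟨A₁ * A₂, A₂' * A₁', ?_, ?_, hcl₁.mul hcl₂, fun r => ?_, fun r => ?_⟩
  · rw [Matrix.mul_assoc, ← Matrix.mul_assoc A₂, h₂, Matrix.one_mul, h₁]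
  · rw [Matrix.mul_assoc, ← Matrix.mul_assoc A₁', h₁', Matrix.one_mul, h₂']
  · rw [Matrix.mul_apply, Finset.sum_eq_single i₁ (fun m _ hm => by
        rw [hfix₂ i₁ (Finset.mem_singleton_self _) m, Matrix.one_apply_ne hm, mul_zero])
      (fun h => absurd (Finset.mem_univ i₁) h), hfix₂ i₁ (Finset.mem_singleton_self _) i₁, Matrix.one_apply_eq, mul_one, hcol₁ r]
  · rw [Matrix.mul_apply, ← hA₁u'']
    simp only [Matrix.mulVec, dotProduct]
    exact Finset.sum_congr rfl fun m _ => by rw [hcol₂ m]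

/-- **`(P)_S` ⇒ the order-one null directions of `P` inside the class span at most a line** (ours; the intrinsic heart of RANK ONE):
`P` weighted homogeneous of weight `μ` (positive weights), the class `S` of weight `μ/p`, `p`-th roots available in `L`, `(P)_S` at some
`i₀ ∈ S`; if `u ≠ 0` and `u'` are supported in `S` with `∂_u P = ∂_{u'} P = 0`, then `u'` is a multiple of `u`.  Proof: otherwise move
`u, u'` to two coordinate slots by ONE class-linear substitution on `P` (chain rule + transport of `(P)_S` and of the weight), where
`card_le_one_of_pderiv_eq_zero_class` forbids them. [cite: Lang2002, Ch. V §6] -/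
theorem ClassPinned.exists_eq_smul_of_dirDeriv_eq_zero (p : ℕ) [Fact p.Prime] [CharP L p] (hperf : ∀ x : L, ∃ y : L, y ^ p = x)
    {w : ι → ℚ} (hw : ∀ j, 0 < w j) {μ : ℚ} {P : MvPolynomial ι L} (hP : IsWeightedHomogeneous w P μ) {S : Finset ι}
    (hS : ∀ i ∈ S, (p : ℚ) * w i = μ) {i₀ : ι} (hi₀ : i₀ ∈ S) (hPin : ClassPinned S P i₀) {u u' : ι → L}
    (huS : ∀ j, j ∉ S → u j = 0) (hu'S : ∀ j, j ∉ S → u' j = 0) (hu0 : u ≠ 0) (hu : dirDeriv u P = 0)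
    (hu' : dirDeriv u' P = 0) : ∃ c : L, u' = c • u := by
  by_contra hcon
  push Not at hcon
  obtain ⟨i₁, hi₁u⟩ : ∃ i₁, u i₁ ≠ 0 := by
    by_contra h
    push Not at h
    exact hu0 (funext h)
  have hi₁ : i₁ ∈ S := by
    by_contra h
    exact hi₁u (huS i₁ h)
  obtain ⟨i₂, hi₂, h12⟩ : ∃ i₂ ∈ S, i₁ ≠ i₂ := by
    by_contra hnone
    push Not at hnone
    apply hcon (u' i₁ / u i₁)
    funext j
    by_cases hj : j = i₁
    · subst hj
      rw [Pi.smul_apply, smul_eq_mul, div_mul_cancel₀ _ hi₁u]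
    · have hjS : j ∉ S := fun hjS => hj (hnone j hjS).symm
      rw [Pi.smul_apply, smul_eq_mul, huS j hjS, hu'S j hjS, mul_zero]
  obtain ⟨A, A', hA, hA', hcl, hc1, hc2⟩ := exists_classLinear_col_eq_two u u' huS hu'S hu0 hcon hi₁ hi₂ h12
  have hwS : ∀ j ∈ S, ∀ k ∈ S, w j = w k := by
    intro j hj k hk
    have hp0 : (p : ℚ) ≠ 0 := Nat.cast_ne_zero.mpr (Fact.out : p.Prime).ne_zero
    exact mul_left_cancel₀ hp0 ((hS j hj).trans (hS k hk).symm)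
  set P' : MvPolynomial ι L := linSubst (fun j k => A j k) P with hP'def
  have hP' : IsWeightedHomogeneous w P' μ := hcl.isWeightedHomogeneous_linSubst hwS hP
  have hPin' : ClassPinned S P' i₀ := hPin.map_linSubst hA hA' hcl
  have hmem : ∀ i ∈ ({i₁, i₂} : Finset ι), i ∈ S := by
    intro i hi
    rw [Finset.mem_insert, Finset.mem_singleton] at hi
    rcases hi with hi | hi <;> rw [hi]
    exacts [hi₁, hi₂]
  have hD : ∀ i ∈ ({i₁, i₂} : Finset ι), pderiv i P' = 0 := by
    intro i hi
    rw [hP'def, pderiv_linSubst]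
    rw [Finset.mem_insert, Finset.mem_singleton] at hi
    rcases hi with hi | hi <;> rw [hi]
    · rw [show (fun j => A j i₁) = u from funext hc1, hu, map_zero]
    · rw [show (fun j => A j i₂) = u' from funext hc2, hu', map_zero]
  have hcard := card_le_one_of_pderiv_eq_zero_class p hw hP' {i₁, i₂} (fun i hi => hS i (hmem i hi)) hD
    (fun i => (hperf (P'.coeff (Finsupp.single i p))).choose) (fun i _ => (hperf (P'.coeff (Finsupp.single i p))).choose_spec) S
    hmem hi₀ hPin'
  rw [Finset.card_pair h12] at hcard
  omega

/-- **THEOREM F STEP 4 / B⁗ (i) RANK ONE, intrinsic form** (ours as a formal statement): let `D = Σ_{i∈S} M_i·∂_i` with ARBITRARY linear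
forms `M_i = Σ_{n∈T} c_{in} X_n` in the `W`-variables `T`, `P` weighted homogeneous of weight `μ` free of the `T`-variables, the class `S`
of weight `μ/p`, `p`-th roots available, `D P = 0` and `(P)_S` at some `i₀ ∈ S`.  Then the coefficient matrix has rank `≤ 1` on `S × T`:
`c_{in} = v_i·λ_n` with `v` supported in `S` — i.e. `D = λ(W)·∂_v`, NO change of the `f`-basis needed. [cite: Lang2002, Ch. V §6] -/
theorem exists_rank_one_of_D_eq_zero_class (p : ℕ) [Fact p.Prime] [CharP L p] (hperf : ∀ x : L, ∃ y : L, y ^ p = x)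
    {w : ι → ℚ} (hw : ∀ j, 0 < w j) {μ : ℚ} {P : MvPolynomial ι L} (hP : IsWeightedHomogeneous w P μ) (S : Finset ι)
    (hS : ∀ i ∈ S, (p : ℚ) * w i = μ) (T : Finset ι) (hPT : ∀ n ∈ T, n ∉ P.vars) (c : ι → ι → L)
    (hDP : ∑ i ∈ S, (∑ n ∈ T, C (c i n) * X n) * pderiv i P = 0) {i₀ : ι} (hi₀ : i₀ ∈ S) (hPin : ClassPinned S P i₀) :
    ∃ v lam : ι → L, (∀ j, j ∉ S → v j = 0) ∧ ∀ i ∈ S, ∀ n ∈ T, c i n = v i * lam n := by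
  -- the columns of `c` (extended by zero off `S`) are null directions of `P`
  let col : ι → ι → L := fun n i => if i ∈ S then c i n else 0
  have hcolS : ∀ n j, j ∉ S → col n j = 0 := fun n j hj => if_neg hj
  have hnull : ∀ n ∈ T, dirDeriv (col n) P = 0 := by
    intro n hn
    have h1 := congrArg (pderiv n) hDP
    rw [map_zero, map_sum] at h1
    rw [dirDeriv, ← h1, ← Finset.sum_subset (Finset.subset_univ S) (fun j _ hjS => by rw [hcolS n j hjS, C_0, zero_mul])]
    refine Finset.sum_congr rfl fun i hi => ?_
    rw [show col n i = c i n from if_pos hi, pderiv_mul, pderiv_eq_zero_of_notMem_vars (notMem_vars_pderiv i (hPT n hn)), mul_zero,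
      add_zero, map_sum, Finset.sum_eq_single_of_mem n hn (fun n' _ hn' => by rw [pderiv_C_mul, pderiv_X_of_ne hn', mul_zero]),
      pderiv_C_mul, pderiv_X_self, mul_one]
  by_cases hzero : ∀ n ∈ T, col n = 0
  · refine ⟨0, 0, fun _ _ => rfl, fun i hi n hn => ?_⟩
    have h := congrFun (hzero n hn) i
    rw [show col n i = c i n from if_pos hi] at h
    rw [h, Pi.zero_apply, Pi.zero_apply, zero_mul]
  · push Not at hzero
    obtain ⟨n₀, hn₀, hcol0⟩ := hzero
    have hdep : ∀ n ∈ T, ∃ a : L, col n = a • col n₀ := fun n hn =>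
      hPin.exists_eq_smul_of_dirDeriv_eq_zero p hperf hw hP hS hi₀ (hcolS n₀) (hcolS n) hcol0 (hnull n₀ hn₀) (hnull n hn)
    choose! lam hlam using hdep
    refine ⟨col n₀, lam, hcolS n₀, fun i hi n hn => ?_⟩
    have h := congrFun (hlam n hn) i
    rw [Pi.smul_apply, smul_eq_mul, show col n i = c i n from if_pos hi] at h
    rw [h, mul_comm]

end InvariantDirection

end Literature.AlgebraicGeometry.Resolution.WeightedBlowup
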